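import Summits.ResolutionOfSingularities.ResolutionOfSingularities.Theorems.FrobeniusLadderFInjectiveMacaulayficationFCUnguardedAprime
import Summits.ResolutionOfSingularities.ResolutionOfSingularities.Theorems.FrobeniusLadderFInjectiveMacaulayficationRegularExceptionalSlices
import Literature.AlgebraicGeometry.Resolution.RegularBlowup
import Literature.AlgebraicGeometry.Resolution.Blowups
import HarnessLib

/-!
# Blow-ups along a centre that is REGULAR inside a regular open `W` are GOOD (indeed FULL) over every `S ⊆ W`
# (crux `FInjectiveMacaulayfication` stmt-ResolutionOfSingularities-15315, chain w45a; res-L1-w45a-plan-1 R16.49 (d4) — the generic scheme-side brick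
# of `goodOver_IC_off_origin`; seat res-L1-w45a-stub-2)

[OURS · L1 W4.5a] Support file (`--supports stmt-ResolutionOfSingularities-15315 --as helper`); NOT a statement of any manuscript; def-free, unconditional;
AI-written (AI review is weaker than expert review).

`full_over_of_isRegular_centre_over_open` / `goodOver_of_isRegular_centre_over_open`: `X₁` locally Noetherian, `W ⊆ X₁` open with `W` REGULAR and
the restricted centre `(J.comap W.ι).subscheme` REGULAR, all stalks of characteristic `p`. Then EVERY blowing up `π : X₂ → X₁` along `J` is FULL
(domain ∧ CM clause ∧ F-clause) at EVERY point over `W`; in particular `GoodOver p X₁ J S` for every `S ⊆ W`. PROOF: `π` restricts over `W` to a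
blowing up of `W` along `J|_W` (`IsBlowup.restrict`, GW 13.91), whose source `π⁻¹W` is regular by Liu 8.1.19 (a)
(`IsBlowup.isRegular_of_isRegular_subscheme`, tree); regular local rings are FULL (`RegularExceptionalSlices.cmClause_and_fClause_of_isRegularLocalRing`).
[cite: Liu2002, Thm. 8.1.19 (a)] [cite: GortzWedhorn2020, Prop. 13.91]
-/

-- single-problem summit: the doubled namespace component is forced
set_option linter.dupNamespace false

noncomputable section

namespace Summit.ResolutionOfSingularities.ResolutionOfSingularities.Theorems.FInjectiveMacaulayfication.GoodOverRegularCentre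

open CategoryTheory AlgebraicGeometry TopologicalSpace IsLocalRing
open Literature.AlgebraicGeometry.Resolution
open Summit.ResolutionOfSingularities.ResolutionOfSingularities.Theorems.FInjectiveMacaulayfication
open FCUnguardedAprime SliceableCentre

/-- **Regular stalks over a regular open with regular restricted centre.** [cite: Liu2002, Thm. 8.1.19 (a)] -/
theorem isRegularLocalRing_stalk_of_isRegular_centre_over_open {X₁ X₂ : Scheme.{0}} [IsLocallyNoetherian X₁] {J : X₁.IdealSheafData}
    {π : X₂ ⟶ X₁} (hπ : IsBlowup π J) (W : X₁.Opens) (hW : Scheme.IsRegular (W : Scheme.{0}))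
    (hC : Scheme.IsRegular (J.comap W.ι).subscheme) (x : X₂) (hx : π.base x ∈ (W : Set X₁)) :
    IsRegularLocalRing (X₂.presheaf.stalk x) := by
  haveI : IsLocallyNoetherian (W : Scheme.{0}) := inferInstance
  have hreg : Scheme.IsRegular (π ⁻¹ᵁ W : Scheme.{0}) := IsBlowup.isRegular_of_isRegular_subscheme hW hC (hπ.restrict W)
  have hxW : x ∈ π ⁻¹ᵁ W := hx
  haveI := hreg ⟨x, hxW⟩
  exact IsRegularLocalRing.of_ringEquiv ((π ⁻¹ᵁ W).stalkIso ⟨x, hxW⟩).commRingCatIsoToRingEquiv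

/-- **FULL over a regular open with regular restricted centre**: every blowing up along `J` is FULL (domain ∧ CM clause ∧ F-clause) at every point over
`W`. [OURS · folklore] [cite: Liu2002, Thm. 8.1.19 (a)] -/
theorem full_over_of_isRegular_centre_over_open {X₁ : Scheme.{0}} [IsLocallyNoetherian X₁] (J : X₁.IdealSheafData) (W : X₁.Opens)
    (hW : Scheme.IsRegular (W : Scheme.{0})) (hC : Scheme.IsRegular (J.comap W.ι).subscheme) (p : ℕ) (hp : p.Prime)
    (hchar : ∀ (X₂ : Scheme.{0}) (π : X₂ ⟶ X₁), IsBlowup π J → ∀ x : X₂, CharP (X₂.presheaf.stalk x) p) :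
    ∀ (X₂ : Scheme.{0}) (π : X₂ ⟶ X₁), IsBlowup π J → ∀ x : X₂, π.base x ∈ (W : Set X₁) → FullCl p (X₂.presheaf.stalk x) := by
  intro X₂ π hπ x hx
  haveI := isRegularLocalRing_stalk_of_isRegular_centre_over_open hπ W hW hC x hx
  haveI := hchar X₂ π hπ x
  haveI : IsDomain (X₂.presheaf.stalk x) := isDomain_of_isRegularLocalRing _
  obtain ⟨hCM, hF⟩ := RegularExceptionalSlices.cmClause_and_fClause_of_isRegularLocalRing hp (X₂.presheaf.stalk x)
  exact ⟨inferInstance, fun d hd s hs => ⟨hCM d hd s hs, hF d hd s hs⟩⟩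

/-- **`GoodOver` over any `S ⊆ W`** (regular open `W`, regular restricted centre). [OURS · folklore] [cite: Liu2002, Thm. 8.1.19 (a)] -/
theorem goodOver_of_isRegular_centre_over_open {X₁ : Scheme.{0}} [IsLocallyNoetherian X₁] (J : X₁.IdealSheafData) (W : X₁.Opens)
    (hW : Scheme.IsRegular (W : Scheme.{0})) (hC : Scheme.IsRegular (J.comap W.ι).subscheme) (p : ℕ) (hp : p.Prime)
    (hchar : ∀ (X₂ : Scheme.{0}) (π : X₂ ⟶ X₁), IsBlowup π J → ∀ x : X₂, CharP (X₂.presheaf.stalk x) p)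
    (S : Set X₁) (hS : S ⊆ (W : Set X₁)) : GoodOver p X₁ J S := by
  intro X₂ π hπ
  have h := full_over_of_isRegular_centre_over_open J W hW hC p hp hchar X₂ π hπ
  refine ⟨fun x hx _ => h x (hS hx), fun x hx _ => ?_⟩
  obtain ⟨-, hF⟩ := h x (hS hx)
  exact fun d hd s hs => (hF d hd s hs).1

end Summit.ResolutionOfSingularities.ResolutionOfSingularities.Theorems.FInjectiveMacaulayfication.GoodOverRegularCentre

end
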